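import Literature.Analysis.FluidPDE.NSUniqueness2DParts
import Literature.Analysis.FluidPDE.NSUniqueness2DLadyzhenskaya
import Literature.Analysis.FluidPDE.NSUniqueness2DTruncatedBalance
import HarnessLib

/-!
# Lions–Prodi uniqueness on `𝕋²`: the difference energy inequality and the discharge

Analysis/FluidPDE discharge file for the named facts
`Literature.Analysis.FluidPDE.lions_prodi_difference_ineq_torus2` (`NSUniqueness2DParts`) and
`Literature.Analysis.FluidPDE.lions_prodi_uniqueness_torus2` (`NSUniqueness2D`; Lions–Prodi 1959;
Foias–Manley–Rosa–Temam 2001, Ch. II, Thm. 7.3; Constantin–Foias 1988, Thm. 10.1;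
Kuksin–Shirikyan 2012, Thm. 2.1.13).

Starting point: the accepted **truncated energy balance** of the difference `w = u - v` of two
Leray–Hopf solutions with the same data (`Torus.IsLerayHopfOn.truncated_difference_balance`,
`NSUniqueness2DTruncatedBalance`, any dimension):
`∫‖P_N w(t)‖² + 2ν ∫₀ᵗ ‖∇P_N w‖₂² = 2∫₀ᵗ [∫⟪u,(u·∇)P_N w⟫ - ∫⟪v,(v·∇)P_N w⟫]`.
Writing `u = v + w` and using weak incompressibility of `v(s)` and `w(s)` against the smooth
scalar `½‖P_N w(s)‖²` (the terms `∫⟪P_N w, (v·∇)P_N w⟫`, `∫⟪P_N w, (w·∇)P_N w⟫` vanish —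
Kuksin–Shirikyan 2012, (2.11)), the time integrand is
`∫⟪v,(w·∇)P_N w⟫ + ∫⟪w - P_N w,(v·∇)P_N w⟫ + ∫⟪w - P_N w,(w·∇)P_N w⟫`, bounded by Hölder
(`4, 4, 2`; `‖DΦ(x)a‖ ≤ ‖a‖ |DΦ(x)|_F`) by
`‖v‖₄‖w‖₄‖∇P_N w‖₂ + ‖w - P_N w‖₄ (‖v‖₄ + ‖w‖₄) ‖∇P_N w‖₂` (KS (2.16)). In two dimensions,
Ladyzhenskaya's inequality (accepted `ladyzhenskaya_torus2_holds`) makes `s ↦ ‖v(s)‖₄⁴`,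
`s ↦ ‖w(s)‖₄⁴` integrable and `∫₀ᵀ ‖w - P_N w‖₄⁴ → 0` (dominated convergence in time of the
accepted slice convergence `tendsto_lintegral_enorm_pow_four_fourierTruncate_sub`), so that as
`N → ∞` (Parseval / monotone convergence on the left, Hölder `4, 4/3` in time on the error) the
balance becomes the **difference energy inequality**
`∫‖w(t)‖² + 2ν∫₀ᵗ‖∇w‖₂² ≤ 2∫₀ᵗ ‖v‖₄‖w‖₄‖∇w‖₂`, i.e. `lions_prodi_difference_ineq_torus2_holds`;
the accepted assembly `lions_prodi_uniqueness_torus2_of_parts` (Young, absorption, Grönwall) then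
gives `lions_prodi_uniqueness_torus2_holds`.

## References

* P. Constantin, C. Foias, *Navier–Stokes Equations*, Chicago 1988, proof of Thm. 10.1,
  (10.3)–(10.6). [ConstantinFoias1988]
* S. Kuksin, A. Shirikyan, *Mathematics of Two-Dimensional Turbulence*, CUP 2012, (1.8),
  Prop. 2.1.7 (2.11)–(2.16), Thm. 2.1.13 (proof). [KuksinShirikyan2012]
* C. Foias, O. Manley, R. Rosa, R. Temam, *Navier–Stokes Equations and Turbulence*, CUP 2001,
  Ch. II, Thm. 7.3. [FoiasManleyRosaTemam2001]
* R. Temam, *Navier–Stokes Equations*, 3rd ed., North-Holland 1984, Ch. III, Thm. 3.2. [Temam1984]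
-/

noncomputable section

open MeasureTheory Set Filter Function UnitAddTorus
open scoped ENNReal NNReal InnerProductSpace RealInnerProductSpace Topology

namespace Literature.Analysis.FluidPDE

namespace Torus

variable {d : Type*} [Fintype d] [DecidableEq d]

/-! ### The trilinear integrand against a smooth field: pointwise and Hölder bounds -/

section Trilinear

/-- **Frobenius bound of the convective derivative**: `‖(b·∇)Φ(x)‖ ≤ ‖b(x)‖ (∑ᵢ ‖∂ᵢΦ(x)‖²)^{1/2}`
for a `C¹` field `Φ` (`(b·∇)Φ = ∑ᵢ bᵢ ∂ᵢΦ` and Cauchy–Schwarz in `i`). [folklore] -/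
theorem norm_convect_le_mul_sqrt {Φ : UnitAddTorus d → EuclideanSpace ℝ d}
    (hΦ : FunctionSpaces.Torus.IsContDiff 1 Φ) (b : UnitAddTorus d → EuclideanSpace ℝ d) (x : UnitAddTorus d) :
    ‖FunctionSpaces.Torus.convect b Φ x‖ ≤
      ‖b x‖ * Real.sqrt (∑ i, ‖FunctionSpaces.Torus.partialDeriv i Φ x‖ ^ 2) := by
  unfold FunctionSpaces.Torus.convect
  rw [FunctionSpaces.Torus.fderiv_apply_eq_sum_partialDeriv hΦ]
  have hCS := Finset.sum_mul_sq_le_sq_mul_sq Finset.univ (fun i => |b x i|)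
    (fun i => ‖FunctionSpaces.Torus.partialDeriv i Φ x‖)
  have hb : ∑ i, |b x i| ^ 2 = ‖b x‖ ^ 2 := by
    rw [EuclideanSpace.norm_sq_eq]
    refine Finset.sum_congr rfl fun i _ => ?_
    rw [Real.norm_eq_abs]
  calc ‖∑ i, b x i • FunctionSpaces.Torus.partialDeriv i Φ x‖
      ≤ ∑ i, ‖b x i • FunctionSpaces.Torus.partialDeriv i Φ x‖ := norm_sum_le _ _
    _ = ∑ i, |b x i| * ‖FunctionSpaces.Torus.partialDeriv i Φ x‖ := by simp [norm_smul]
    _ ≤ Real.sqrt ((∑ i, |b x i| ^ 2) * ∑ i, ‖FunctionSpaces.Torus.partialDeriv i Φ x‖ ^ 2) :=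
        (le_abs_self _).trans (Real.abs_le_sqrt hCS)
    _ = ‖b x‖ * Real.sqrt (∑ i, ‖FunctionSpaces.Torus.partialDeriv i Φ x‖ ^ 2) := by
        rw [hb, Real.sqrt_mul (sq_nonneg _), Real.sqrt_sq (norm_nonneg _)]

omit [DecidableEq d] in
/-- `(∫⁻ (a b)²)^{1/2} ≤ (∫⁻ a⁴)^{1/4} (∫⁻ b⁴)^{1/4}` for `ℝ≥0∞`-valued functions
(Cauchy–Schwarz for `a²`, `b²`). [folklore] -/
theorem lintegral_mul_sq_rpow_half_le {X : Type*} [MeasurableSpace X] (μ : Measure X)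
    {a b : X → ℝ≥0∞} (ha : AEMeasurable a μ) (hb : AEMeasurable b μ) :
    (∫⁻ x, (a x * b x) ^ 2 ∂μ) ^ (1 / 2 : ℝ) ≤
      (∫⁻ x, a x ^ 4 ∂μ) ^ (1 / 4 : ℝ) * (∫⁻ x, b x ^ 4 ∂μ) ^ (1 / 4 : ℝ) := by
  have h := ENNReal.lintegral_mul_le_Lp_mul_Lq μ Real.HolderConjugate.two_two
    (ha.pow_const 2) (hb.pow_const 2)
  have h4 : ∀ (c : X → ℝ≥0∞), (fun x => (c x ^ 2) ^ (2 : ℝ)) = fun x => c x ^ 4 := fun c => by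
    funext x; rw [ENNReal.rpow_two, ← pow_mul]
  simp only [Pi.mul_apply, h4] at h
  calc (∫⁻ x, (a x * b x) ^ 2 ∂μ) ^ (1 / 2 : ℝ)
      = (∫⁻ x, a x ^ 2 * b x ^ 2 ∂μ) ^ (1 / 2 : ℝ) := by simp_rw [mul_pow]
    _ ≤ ((∫⁻ x, a x ^ 4 ∂μ) ^ (1 / (2 : ℝ)) * (∫⁻ x, b x ^ 4 ∂μ) ^ (1 / (2 : ℝ))) ^ (1 / 2 : ℝ) :=
        ENNReal.rpow_le_rpow h (by norm_num)
    _ = (∫⁻ x, a x ^ 4 ∂μ) ^ (1 / 4 : ℝ) * (∫⁻ x, b x ^ 4 ∂μ) ^ (1 / 4 : ℝ) := by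
        rw [ENNReal.mul_rpow_of_nonneg _ _ (by norm_num), ← ENNReal.rpow_mul, ← ENNReal.rpow_mul]
        norm_num

/-- **Hölder `(4, 4, 2)` for the trilinear integrand**: for a.e. strongly measurable fields `a`,
`b` and a smooth `Φ` on `T^d`,
`∫⁻ ‖⟪a, (b·∇)Φ⟫‖ₑ ≤ ‖a‖_{L⁴} ‖b‖_{L⁴} ‖∇Φ‖₂`
(`‖·‖_{L⁴} = (∫⁻‖·‖ₑ⁴)^{1/4}`, `‖∇Φ‖₂² = eGradNormSq Φ = ∑ᵢ∫‖∂ᵢΦ‖²`; Kuksin–Shirikyan 2012, (2.16),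
first line). [cite: KuksinShirikyan2012, Prop. 2.1.7 (2.16)] -/
theorem lintegral_enorm_inner_convect_le {a b : UnitAddTorus d → EuclideanSpace ℝ d}
    (ha : AEStronglyMeasurable a volume) (hb : AEStronglyMeasurable b volume)
    {Φ : UnitAddTorus d → EuclideanSpace ℝ d} (hΦ : FunctionSpaces.Torus.IsSmooth Φ) :
    ∫⁻ x, ‖⟪a x, FunctionSpaces.Torus.convect b Φ x⟫‖ₑ ≤
      (∫⁻ x, ‖a x‖ₑ ^ 4) ^ (1 / 4 : ℝ) * (∫⁻ x, ‖b x‖ₑ ^ 4) ^ (1 / 4 : ℝ) *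
        FunctionSpaces.Torus.eGradNormSq Φ ^ (1 / 2 : ℝ) := by
  set F : UnitAddTorus d → ℝ≥0∞ := fun x =>
    ENNReal.ofReal (Real.sqrt (∑ i, ‖FunctionSpaces.Torus.partialDeriv i Φ x‖ ^ 2)) with hF
  have hΦ1 : FunctionSpaces.Torus.IsContDiff 1 Φ := hΦ.isContDiff (by simp)
  -- pointwise
  have hpt : ∀ x, ‖⟪a x, FunctionSpaces.Torus.convect b Φ x⟫‖ₑ ≤ (‖a x‖ₑ * ‖b x‖ₑ) * F x := by
    intro x
    rw [Real.enorm_eq_ofReal_abs, ← ofReal_norm, ← ofReal_norm, ← ENNReal.ofReal_mul (norm_nonneg _),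
      ← ENNReal.ofReal_mul (by positivity)]
    refine ENNReal.ofReal_le_ofReal ((abs_real_inner_le_norm _ _).trans ?_)
    rw [mul_assoc]
    exact mul_le_mul_of_nonneg_left (norm_convect_le_mul_sqrt hΦ1 b x) (norm_nonneg _)
  -- the Frobenius mass
  have hcont : Continuous fun x => ∑ i, ‖FunctionSpaces.Torus.partialDeriv i Φ x‖ ^ 2 :=
    continuous_finsetSum _ fun i _ => (hΦ.partialDeriv i).continuous.norm.pow 2
  have hFm : AEMeasurable F volume :=
    (ENNReal.continuous_ofReal.comp (Real.continuous_sqrt.comp hcont)).measurable.aemeasurable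
  have hF2 : ∫⁻ x, F x ^ 2 = FunctionSpaces.Torus.eGradNormSq Φ := by
    rw [← Torus.sum_lintegral_enorm_sq_partialDeriv_eq_eGradNormSq hΦ, ← lintegral_finsetSum' _
      fun i _ => ((hΦ.partialDeriv i).continuous.enorm.measurable.pow_const 2).aemeasurable]
    refine lintegral_congr fun x => ?_
    rw [hF, ← ENNReal.ofReal_pow (Real.sqrt_nonneg _), Real.sq_sqrt (Finset.sum_nonneg fun i _ => sq_nonneg _),
      ENNReal.ofReal_sum_of_nonneg fun i _ => sq_nonneg _]
    refine Finset.sum_congr rfl fun i _ => ?_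
    rw [← ofReal_norm, ENNReal.ofReal_pow (norm_nonneg _)]
  have ham : AEMeasurable (fun x => ‖a x‖ₑ) volume := ha.aemeasurable.enorm
  have hbm : AEMeasurable (fun x => ‖b x‖ₑ) volume := hb.aemeasurable.enorm
  calc ∫⁻ x, ‖⟪a x, FunctionSpaces.Torus.convect b Φ x⟫‖ₑ ≤ ∫⁻ x, (‖a x‖ₑ * ‖b x‖ₑ) * F x :=
        lintegral_mono hpt
    _ ≤ (∫⁻ x, (‖a x‖ₑ * ‖b x‖ₑ) ^ (2 : ℝ)) ^ (1 / (2 : ℝ)) * (∫⁻ x, F x ^ (2 : ℝ)) ^ (1 / (2 : ℝ)) :=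
        ENNReal.lintegral_mul_le_Lp_mul_Lq volume Real.HolderConjugate.two_two (ham.mul hbm) hFm
    _ ≤ ((∫⁻ x, ‖a x‖ₑ ^ 4) ^ (1 / 4 : ℝ) * (∫⁻ x, ‖b x‖ₑ ^ 4) ^ (1 / 4 : ℝ)) *
          FunctionSpaces.Torus.eGradNormSq Φ ^ (1 / 2 : ℝ) := by
        simp only [ENNReal.rpow_two]
        rw [hF2]
        exact mul_le_mul' (lintegral_mul_sq_rpow_half_le volume ham hbm) le_rfl

/-- Measurability of the mixed trilinear integrand `x ↦ ⟪p, (q·∇)Φ⟫`. [folklore] -/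
theorem aestronglyMeasurable_inner_convect' {p q : UnitAddTorus d → EuclideanSpace ℝ d}
    (hp : AEStronglyMeasurable p volume) (hq : AEStronglyMeasurable q volume)
    {Φ : UnitAddTorus d → EuclideanSpace ℝ d} (hΦ : FunctionSpaces.Torus.IsSmooth Φ) :
    AEStronglyMeasurable (fun x => ⟪p x, FunctionSpaces.Torus.convect q Φ x⟫) volume := by
  have h : (fun x => FunctionSpaces.Torus.convect q Φ x) =
      fun x => ∑ i, (q x) i • FunctionSpaces.Torus.partialDeriv i Φ x := by
    funext x; exact FunctionSpaces.Torus.fderiv_apply_eq_sum_partialDeriv (hΦ.isContDiff (by simp)) _ _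
  have hconv : AEStronglyMeasurable (fun x => FunctionSpaces.Torus.convect q Φ x) volume := by
    rw [h]
    exact Finset.aestronglyMeasurable_fun_sum _ fun i _ =>
      ((EuclideanSpace.proj (𝕜 := ℝ) i).continuous.comp_aestronglyMeasurable hq).smul
        (hΦ.partialDeriv i).continuous.aestronglyMeasurable
  exact hp.inner hconv

/-- Integrability of the mixed trilinear integrand `x ↦ ⟪p, (q·∇)Φ⟫` for `p, q ∈ L²` and a
smooth `Φ` (`|⟪p,(q·∇)Φ⟫| ≤ (sup ∑ᵢ‖∂ᵢΦ‖) ‖p‖‖q‖ ≤ D(‖p‖² + ‖q‖²)/2`). [folklore] -/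
theorem integrable_inner_convect' {p q : UnitAddTorus d → EuclideanSpace ℝ d}
    (hp : MemLp p 2 volume) (hq : MemLp q 2 volume)
    {Φ : UnitAddTorus d → EuclideanSpace ℝ d} (hΦ : FunctionSpaces.Torus.IsSmooth Φ) :
    Integrable (fun x => ⟪p x, FunctionSpaces.Torus.convect q Φ x⟫) volume := by
  obtain ⟨D, hD0, hD⟩ := exists_sum_norm_partialDeriv_le hΦ
  refine Integrable.mono' ((((hp.integrable_norm_pow two_ne_zero).add
    (hq.integrable_norm_pow two_ne_zero))).const_mul (D / 2))
    (aestronglyMeasurable_inner_convect' hp.1 hq.1 hΦ) (ae_of_all _ fun x => ?_)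
  rw [Real.norm_eq_abs]
  have h1 := FunctionSpaces.Torus.norm_convect_le q (hΦ.isContDiff (by simp)) x
  calc |⟪p x, FunctionSpaces.Torus.convect q Φ x⟫| ≤ ‖p x‖ * ‖FunctionSpaces.Torus.convect q Φ x‖ :=
        abs_real_inner_le_norm _ _
    _ ≤ ‖p x‖ * (‖q x‖ * D) := by gcongr; exact h1.trans (mul_le_mul_of_nonneg_left (hD x) (norm_nonneg _))
    _ ≤ D / 2 * (‖p x‖ ^ 2 + ‖q x‖ ^ 2) := by nlinarith [sq_nonneg (‖p x‖ - ‖q x‖), norm_nonneg (p x), norm_nonneg (q x)]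
    _ = D / 2 * ((fun x => ‖p x‖ ^ 2) + fun x => ‖q x‖ ^ 2) x := rfl

omit [DecidableEq d] in
/-- **The trilinear term with two equal arguments vanishes weakly**: if `V ∈ L²(T^d)` is weakly
divergence free and `Φ` is smooth, then `∫ ⟪Φ, (V·∇)Φ⟫ = 0` — test weak incompressibility with
the smooth scalar `½‖Φ‖²`, `⟪Φ, DΦ(x)V⟫ = ⟪V, ∇(½‖Φ‖²)⟫` (Kuksin–Shirikyan 2012, (2.11):
`⟨B(u,v), v⟩ = ½∫ u·∇|v|² = 0`). [cite: KuksinShirikyan2012, Prop. 2.1.7 (2.11)] -/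
theorem integral_inner_self_convect_eq_zero_of_isWeaklyDivFree {V : UnitAddTorus d → EuclideanSpace ℝ d}
    (hV : FunctionSpaces.Torus.IsWeaklyDivFree V) {Φ : UnitAddTorus d → EuclideanSpace ℝ d}
    (hΦ : FunctionSpaces.Torus.IsSmooth Φ) :
    ∫ x, ⟪Φ x, FunctionSpaces.Torus.convect V Φ x⟫ = 0 := by
  set θ : UnitAddTorus d → ℝ := fun y => (2 : ℝ)⁻¹ • ‖Φ y‖ ^ 2 with hθ
  have hθs : FunctionSpaces.Torus.IsSmooth θ := (hΦ.norm_sq).smul (2 : ℝ)⁻¹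
  have hpt : ∀ x, ⟪V x, FunctionSpaces.Torus.gradient θ x⟫ = ⟪Φ x, FunctionSpaces.Torus.convect V Φ x⟫ := by
    intro x
    rw [real_inner_comm, FunctionSpaces.Torus.inner_gradient_left, hθ,
      show (fun y => (2 : ℝ)⁻¹ • ‖Φ y‖ ^ 2) = (2 : ℝ)⁻¹ • fun y => ‖Φ y‖ ^ 2 from rfl,
      FunctionSpaces.Torus.fderiv_const_smul ((hΦ.norm_sq).isContDiff (n := 1) (by simp)),
      FunLike.coe_smul, Pi.smul_apply,
      FunctionSpaces.Torus.fderiv_norm_sq_apply (hΦ.isContDiff (by simp)), smul_eq_mul]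
    unfold FunctionSpaces.Torus.convect
    ring
  have h := hV θ hθs
  simp_rw [hpt] at h
  exact h

/-- **The nonlinear term of the truncated balance, rewritten and bounded.** Let `U, V ∈ L²(T^d)`,
`W = U - V`, `Φ` smooth, with `V` and `W` weakly divergence free. Then
`∫⟪U,(U·∇)Φ⟫ - ∫⟪V,(V·∇)Φ⟫ = ∫⟪V,(W·∇)Φ⟫ + ∫⟪W - Φ,(V·∇)Φ⟫ + ∫⟪W - Φ,(W·∇)Φ⟫`
(bilinearity and the two cancellations `∫⟪Φ,(V·∇)Φ⟫ = ∫⟪Φ,(W·∇)Φ⟫ = 0`), whence in `ℝ≥0∞`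
`‖∫⟪U,(U·∇)Φ⟫ - ∫⟪V,(V·∇)Φ⟫‖ₑ ≤ ‖V‖₄‖W‖₄‖∇Φ‖₂ + ‖W - Φ‖₄ (‖V‖₄ + ‖W‖₄) ‖∇Φ‖₂`
(Kuksin–Shirikyan 2012, proof of Thm. 2.1.13 with (2.11)–(2.16)). [cite: KuksinShirikyan2012, Thm. 2.1.13 (proof)] -/
theorem enorm_trilinear_sub_le {U V : UnitAddTorus d → EuclideanSpace ℝ d} (hU : MemLp U 2 volume)
    (hV : MemLp V 2 volume) (hVdiv : FunctionSpaces.Torus.IsWeaklyDivFree V)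
    (hWdiv : FunctionSpaces.Torus.IsWeaklyDivFree (U - V)) {Φ : UnitAddTorus d → EuclideanSpace ℝ d}
    (hΦ : FunctionSpaces.Torus.IsSmooth Φ) :
    ‖(∫ x, ⟪U x, FunctionSpaces.Torus.convect U Φ x⟫) - ∫ x, ⟪V x, FunctionSpaces.Torus.convect V Φ x⟫‖ₑ ≤
      (∫⁻ x, ‖V x‖ₑ ^ 4) ^ (1 / 4 : ℝ) * (∫⁻ x, ‖(U - V) x‖ₑ ^ 4) ^ (1 / 4 : ℝ) *
          FunctionSpaces.Torus.eGradNormSq Φ ^ (1 / 2 : ℝ) +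
        (∫⁻ x, ‖(U - V) x - Φ x‖ₑ ^ 4) ^ (1 / 4 : ℝ) *
          ((∫⁻ x, ‖V x‖ₑ ^ 4) ^ (1 / 4 : ℝ) + (∫⁻ x, ‖(U - V) x‖ₑ ^ 4) ^ (1 / 4 : ℝ)) *
          FunctionSpaces.Torus.eGradNormSq Φ ^ (1 / 2 : ℝ) := by
  set W : UnitAddTorus d → EuclideanSpace ℝ d := U - V with hW
  have hWm : MemLp W 2 volume := hU.sub hV
  have hΦm : MemLp Φ 2 volume := hΦ.memLp 2
  have hRm : MemLp (W - Φ) 2 volume := hWm.sub hΦm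
  -- ### the algebraic rewriting
  have hUVW : U = V + W := by rw [hW]; abel
  have i := fun (p q : UnitAddTorus d → EuclideanSpace ℝ d) (hp : MemLp p 2 volume) (hq : MemLp q 2 volume) =>
    integrable_inner_convect' hp hq hΦ
  have hlin : ∀ (p q : UnitAddTorus d → EuclideanSpace ℝ d) x,
      FunctionSpaces.Torus.convect (p + q) Φ x = FunctionSpaces.Torus.convect p Φ x + FunctionSpaces.Torus.convect q Φ x :=
    fun p q x => by simp only [FunctionSpaces.Torus.convect, Pi.add_apply, map_add]
  have hlin' : ∀ (p q : UnitAddTorus d → EuclideanSpace ℝ d) x,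
      FunctionSpaces.Torus.convect (p - q) Φ x = FunctionSpaces.Torus.convect p Φ x - FunctionSpaces.Torus.convect q Φ x :=
    fun p q x => by simp only [FunctionSpaces.Torus.convect, Pi.sub_apply, map_sub]
  have h1 : (∫ x, ⟪U x, FunctionSpaces.Torus.convect U Φ x⟫) - ∫ x, ⟪V x, FunctionSpaces.Torus.convect V Φ x⟫ =
      (∫ x, ⟪V x, FunctionSpaces.Torus.convect W Φ x⟫) + (∫ x, ⟪W x, FunctionSpaces.Torus.convect V Φ x⟫) +
        ∫ x, ⟪W x, FunctionSpaces.Torus.convect W Φ x⟫ := by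
    have hpt : ∀ x, ⟪U x, FunctionSpaces.Torus.convect U Φ x⟫ =
        ⟪V x, FunctionSpaces.Torus.convect V Φ x⟫ + (⟪V x, FunctionSpaces.Torus.convect W Φ x⟫ +
          ⟪W x, FunctionSpaces.Torus.convect V Φ x⟫ + ⟪W x, FunctionSpaces.Torus.convect W Φ x⟫) := by
      intro x
      rw [hUVW, hlin, Pi.add_apply, inner_add_left, inner_add_right, inner_add_right]
      ring
    simp_rw [hpt]
    have i23 : Integrable (fun x => ⟪V x, FunctionSpaces.Torus.convect W Φ x⟫ +
        ⟪W x, FunctionSpaces.Torus.convect V Φ x⟫) volume := (i V W hV hWm).add (i W V hWm hV)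
    have i234 : Integrable (fun x => ⟪V x, FunctionSpaces.Torus.convect W Φ x⟫ +
        ⟪W x, FunctionSpaces.Torus.convect V Φ x⟫ + ⟪W x, FunctionSpaces.Torus.convect W Φ x⟫) volume :=
      i23.add (i W W hWm hWm)
    rw [integral_add (i V V hV hV) i234, integral_add i23 (i W W hWm hWm),
      integral_add (i V W hV hWm) (i W V hWm hV)]
    ring
  -- ### the cancellations
  have hc1 : ∫ x, ⟪W x, FunctionSpaces.Torus.convect V Φ x⟫ = ∫ x, ⟪(W - Φ) x, FunctionSpaces.Torus.convect V Φ x⟫ := by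
    have hpt : ∀ x, ⟪W x, FunctionSpaces.Torus.convect V Φ x⟫ =
        ⟪(W - Φ) x, FunctionSpaces.Torus.convect V Φ x⟫ + ⟪Φ x, FunctionSpaces.Torus.convect V Φ x⟫ := by
      intro x; rw [Pi.sub_apply, inner_sub_left]; ring
    simp_rw [hpt]
    rw [integral_add (i _ _ hRm hV) (i _ _ hΦm hV),
      integral_inner_self_convect_eq_zero_of_isWeaklyDivFree hVdiv hΦ, add_zero]
  have hc2 : ∫ x, ⟪W x, FunctionSpaces.Torus.convect W Φ x⟫ = ∫ x, ⟪(W - Φ) x, FunctionSpaces.Torus.convect W Φ x⟫ := by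
    have hpt : ∀ x, ⟪W x, FunctionSpaces.Torus.convect W Φ x⟫ =
        ⟪(W - Φ) x, FunctionSpaces.Torus.convect W Φ x⟫ + ⟪Φ x, FunctionSpaces.Torus.convect W Φ x⟫ := by
      intro x; rw [Pi.sub_apply, inner_sub_left]; ring
    simp_rw [hpt]
    rw [integral_add (i _ _ hRm hWm) (i _ _ hΦm hWm),
      integral_inner_self_convect_eq_zero_of_isWeaklyDivFree hWdiv hΦ, add_zero]
  rw [h1, hc1, hc2]
  -- ### the bounds
  have b1 := lintegral_enorm_inner_convect_le hV.1 hWm.1 hΦ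
  have b2 := lintegral_enorm_inner_convect_le hRm.1 hV.1 hΦ
  have b3 := lintegral_enorm_inner_convect_le hRm.1 hWm.1 hΦ
  calc ‖(∫ x, ⟪V x, FunctionSpaces.Torus.convect W Φ x⟫) + (∫ x, ⟪(W - Φ) x, FunctionSpaces.Torus.convect V Φ x⟫) +
        ∫ x, ⟪(W - Φ) x, FunctionSpaces.Torus.convect W Φ x⟫‖ₑ
      ≤ ‖∫ x, ⟪V x, FunctionSpaces.Torus.convect W Φ x⟫‖ₑ + ‖∫ x, ⟪(W - Φ) x, FunctionSpaces.Torus.convect V Φ x⟫‖ₑ +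
          ‖∫ x, ⟪(W - Φ) x, FunctionSpaces.Torus.convect W Φ x⟫‖ₑ :=
        (enorm_add_le _ _).trans (add_le_add (enorm_add_le _ _) le_rfl)
    _ ≤ (∫⁻ x, ‖⟪V x, FunctionSpaces.Torus.convect W Φ x⟫‖ₑ) + (∫⁻ x, ‖⟪(W - Φ) x, FunctionSpaces.Torus.convect V Φ x⟫‖ₑ) +
          ∫⁻ x, ‖⟪(W - Φ) x, FunctionSpaces.Torus.convect W Φ x⟫‖ₑ :=
        add_le_add (add_le_add (enorm_integral_le_lintegral_enorm _) (enorm_integral_le_lintegral_enorm _))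
          (enorm_integral_le_lintegral_enorm _)
    _ ≤ _ := by
        refine (add_le_add (add_le_add b1 b2) b3).trans (le_of_eq ?_)
        simp only [hW, Pi.sub_apply]
        ring

end Trilinear

/-! ### Spectral finite sums for truncations -/

section Spectral

omit [DecidableEq d] in
/-- **`L²` mass of a truncation, `ℝ≥0∞` form**: `∫⁻ ‖P_N W‖ₑ² = ∑_{|k|≤N} ‖Ŵ(k)‖ₑ²` for integrable
`W` (finite Parseval `Torus.integral_norm_sq_fourierTruncate`). [folklore] -/
theorem lintegral_enorm_sq_fourierTruncate_eq_sum [DecidableEq d] {W : UnitAddTorus d → EuclideanSpace ℝ d}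
    (hW : Integrable W volume) (N : ℕ) :
    ∫⁻ x, ‖FunctionSpaces.Torus.fourierTruncate N W x‖ₑ ^ 2 =
      ∑ k ∈ FunctionSpaces.Torus.freqBall N,
        ‖mFourierCoeff (FunctionSpaces.EuclideanSpace.complexify ∘ W) k‖ₑ ^ 2 := by
  rw [Torus.lintegral_enorm_sq_eq_ofReal (FunctionSpaces.Torus.memLp_fourierTruncate N W 2),
    FunctionSpaces.Torus.integral_norm_sq_fourierTruncate hW N,
    ENNReal.ofReal_sum_of_nonneg fun k _ => sq_nonneg _]
  refine Finset.sum_congr rfl fun k _ => ?_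
  rw [← ofReal_norm, ENNReal.ofReal_pow (norm_nonneg _)]

omit [DecidableEq d] in
/-- The spectral dissipation of the truncation error is at most that of the field:
`‖∇(P_N v - v)‖₂² ≤ ‖∇v‖₂²`. [folklore] -/
theorem eGradNormSq_fourierTruncate_sub_le [DecidableEq d] {v : UnitAddTorus d → EuclideanSpace ℝ d}
    (hv : Integrable v volume) (N : ℕ) :
    FunctionSpaces.Torus.eGradNormSq (FunctionSpaces.Torus.fourierTruncate N v - v) ≤
      FunctionSpaces.Torus.eGradNormSq v := by
  rw [FunctionSpaces.Torus.eGradNormSq_eq_tsum, FunctionSpaces.Torus.eGradNormSq_eq_tsum]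
  refine mul_le_mul' le_rfl (ENNReal.tsum_le_tsum fun k => ?_)
  rw [FunctionSpaces.Torus.mFourierCoeff_fourierTruncate_sub hv]
  split_ifs
  · simp
  · rw [enorm_neg]

omit [DecidableEq d] in
/-- The `L²` truncation error is at most the `L²` mass: `∫⁻ ‖P_N v - v‖ₑ² ≤ ∫⁻ ‖v‖ₑ²`. [folklore] -/
theorem lintegral_enorm_sq_fourierTruncate_sub_le' [DecidableEq d] {v : UnitAddTorus d → EuclideanSpace ℝ d}
    (hv : MemLp v 2 volume) (N : ℕ) :
    ∫⁻ x, ‖FunctionSpaces.Torus.fourierTruncate N v x - v x‖ₑ ^ 2 ≤ ∫⁻ x, ‖v x‖ₑ ^ 2 := by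
  rw [FunctionSpaces.Torus.lintegral_enorm_sq_fourierTruncate_sub hv N,
    ← FunctionSpaces.Torus.tsum_enorm_sq_mFourierCoeff_complexify hv]
  exact ENNReal.tsum_comp_le_tsum_of_injective Subtype.val_injective _

end Spectral

/-! ### Leray–Hopf solutions: measurability in time of the spectral objects of the difference -/

section Measurability

variable {T ν : ℝ} {f u v : ℝ → UnitAddTorus d → EuclideanSpace ℝ d}
  {u₀ : UnitAddTorus d → EuclideanSpace ℝ d}

/-- Time-measurability of the spatial Fourier coefficients of a Leray–Hopf solution (Fubini). [folklore] -/
theorem IsLerayHopfOn.aestronglyMeasurable_mFourierCoeff_complexify (hu : IsLerayHopfOn T ν f u₀ u)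
    (k : d → ℤ) :
    AEStronglyMeasurable (fun s => mFourierCoeff (FunctionSpaces.EuclideanSpace.complexify ∘ u s) k)
      (volume.restrict (Ioo 0 T)) := by
  have hF := hu.aestronglyMeasurable_uncurry
  have hG : AEStronglyMeasurable (fun p : ℝ × UnitAddTorus d =>
      mFourier (-k) p.2 • FunctionSpaces.EuclideanSpace.complexify (uncurry u p))
      ((volume.restrict (Ioo 0 T)).prod volume) :=
    ((mFourier (-k)).continuous.comp continuous_snd).aestronglyMeasurable.smul
      (FunctionSpaces.EuclideanSpace.continuous_complexify.comp_aestronglyMeasurable hF)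
  refine hG.integral_prod_right'.congr (ae_of_all _ fun t => ?_)
  simp only [FunctionSpaces.Torus.mFourierCoeff_eq_integral_volume, comp_apply, uncurry_apply_pair]

/-- Time-measurability of the Fourier coefficients of the difference of two Leray–Hopf solutions. [folklore] -/
theorem IsLerayHopfOn.aestronglyMeasurable_mFourierCoeff_complexify_sub (hu : IsLerayHopfOn T ν f u₀ u)
    (hv : IsLerayHopfOn T ν f u₀ v) (k : d → ℤ) :
    AEStronglyMeasurable
      (fun s => mFourierCoeff (FunctionSpaces.EuclideanSpace.complexify ∘ (u s - v s)) k)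
      (volume.restrict (Ioo 0 T)) := by
  refine ((hu.aestronglyMeasurable_mFourierCoeff_complexify k).sub
    (hv.aestronglyMeasurable_mFourierCoeff_complexify k)).congr ?_
  filter_upwards [ae_restrict_mem measurableSet_Ioo] with s hs
  exact (Torus.mFourierCoeff_complexify_sub ((hu.memLp s (Ioo_subset_Icc_self hs)).integrable one_le_two)
    ((hv.memLp s (Ioo_subset_Icc_self hs)).integrable one_le_two) k).symm

/-- Time-measurability of the spectral dissipation `s ↦ ‖∇(u(s) - v(s))‖₂²` of the difference. [folklore] -/
theorem IsLerayHopfOn.aemeasurable_eGradNormSq_sub (hu : IsLerayHopfOn T ν f u₀ u)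
    (hv : IsLerayHopfOn T ν f u₀ v) :
    AEMeasurable (fun s => FunctionSpaces.Torus.eGradNormSq (u s - v s)) (volume.restrict (Ioo 0 T)) :=
  Torus.aemeasurable_eGradNormSq_of_coeff (hu.aestronglyMeasurable_mFourierCoeff_complexify_sub hv)

/-- Time-measurability of the dissipation of the truncated difference, with the finite-sum
formula `‖∇P_N w(s)‖₂² = 4π² ∑_{|k|≤N} |k|² ‖ŵ(s)(k)‖ₑ²`. [folklore] -/
theorem IsLerayHopfOn.aemeasurable_eGradNormSq_fourierTruncate_sub (hu : IsLerayHopfOn T ν f u₀ u)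
    (hv : IsLerayHopfOn T ν f u₀ v) (N : ℕ) :
    AEMeasurable (fun s => FunctionSpaces.Torus.eGradNormSq
      (FunctionSpaces.Torus.fourierTruncate N (u s - v s))) (volume.restrict (Ioo 0 T)) := by
  have h : AEMeasurable (fun s => ENNReal.ofReal (4 * Real.pi ^ 2) * ∑ k ∈ FunctionSpaces.Torus.freqBall N,
      ENNReal.ofReal (FunctionSpaces.Torus.freqNormSq k) *
        ‖mFourierCoeff (FunctionSpaces.EuclideanSpace.complexify ∘ (u s - v s)) k‖ₑ ^ 2)
      (volume.restrict (Ioo 0 T)) :=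
    (Finset.aemeasurable_fun_sum _ fun k _ =>
      ((hu.aestronglyMeasurable_mFourierCoeff_complexify_sub hv k).enorm.pow_const 2).const_mul _).const_mul _
  refine h.congr ?_
  filter_upwards [ae_restrict_mem measurableSet_Ioo] with s hs
  exact (eGradNormSq_fourierTruncate_eq_sum (((hu.memLp s (Ioo_subset_Icc_self hs)).sub
    (hv.memLp s (Ioo_subset_Icc_self hs))).integrable one_le_two) N).symm

/-- **Joint measurability of the truncated difference**: `(s, x) ↦ P_N (u(s) - v(s))(x)` is a.e.
strongly measurable on `(0,T) × T^d` (a finite sum of modes `Re (e_k(x) ŵ(s)(k))`, measurable in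
`s` and continuous in `x`). [folklore] -/
theorem IsLerayHopfOn.aestronglyMeasurable_uncurry_fourierTruncate_sub (hu : IsLerayHopfOn T ν f u₀ u)
    (hv : IsLerayHopfOn T ν f u₀ v) (N : ℕ) :
    AEStronglyMeasurable (fun p : ℝ × UnitAddTorus d =>
      FunctionSpaces.Torus.fourierTruncate N (u p.1 - v p.1) p.2) ((volume.restrict (Ioo 0 T)).prod volume) := by
  have h : (fun p : ℝ × UnitAddTorus d => FunctionSpaces.Torus.fourierTruncate N (u p.1 - v p.1) p.2) =
      fun p => ∑ k ∈ FunctionSpaces.Torus.freqBall N, FunctionSpaces.EuclideanSpace.realPart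
        (mFourier k p.2 • mFourierCoeff (FunctionSpaces.EuclideanSpace.complexify ∘ (u p.1 - v p.1)) k) := by
    funext p
    rw [FunctionSpaces.Torus.fourierTruncate_eq, FunctionSpaces.Torus.realTrigPoly_apply_eq_sum]
  rw [h]
  refine Finset.aestronglyMeasurable_fun_sum _ fun k _ => ?_
  refine FunctionSpaces.EuclideanSpace.realPart.continuous.comp_aestronglyMeasurable ?_
  exact ((mFourier k).continuous.comp continuous_snd).aestronglyMeasurable.smul
    ((hu.aestronglyMeasurable_mFourierCoeff_complexify_sub hv k).comp_fst)

/-- Time-measurability of the `L⁴` truncation error `s ↦ ∫⁻ ‖P_N w(s) - w(s)‖ₑ⁴`. [folklore] -/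
theorem IsLerayHopfOn.aemeasurable_lintegral_enorm_pow_four_fourierTruncate_sub (hu : IsLerayHopfOn T ν f u₀ u)
    (hv : IsLerayHopfOn T ν f u₀ v) (N : ℕ) :
    AEMeasurable (fun s => ∫⁻ x, ‖FunctionSpaces.Torus.fourierTruncate N (u s - v s) x - (u s - v s) x‖ₑ ^ 4)
      (volume.restrict (Ioo 0 T)) := by
  have h := ((hu.aestronglyMeasurable_uncurry_fourierTruncate_sub hv N).sub
    (hu.aestronglyMeasurable_uncurry.sub hv.aestronglyMeasurable_uncurry)).aemeasurable.enorm.pow_const 4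
  exact h.lintegral_prod_right'

/-- Time-measurability of `s ↦ ∫⁻ ‖u(s) - v(s)‖ₑ^p`. [folklore] -/
theorem IsLerayHopfOn.aemeasurable_lintegral_enorm_pow_sub (hu : IsLerayHopfOn T ν f u₀ u)
    (hv : IsLerayHopfOn T ν f u₀ v) (p : ℕ) :
    AEMeasurable (fun s => ∫⁻ x, ‖(u s - v s) x‖ₑ ^ p) (volume.restrict (Ioo 0 T)) :=
  ((hu.aestronglyMeasurable_uncurry.sub hv.aestronglyMeasurable_uncurry).aemeasurable.enorm.pow_const
    p).lintegral_prod_right'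

omit [DecidableEq d] in
/-- Fourier coefficients are bounded by the `L¹` norm: `‖ĝ(k)‖ ≤ ∫ ‖g‖` for integrable `g`
(`|e_{-k}| ≤ 1`). [folklore] -/
theorem norm_mFourierCoeff_le_integral_norm {F : Type*} [NormedAddCommGroup F] [NormedSpace ℂ F]
    {g : UnitAddTorus d → F} (hg : Integrable g volume) (k : d → ℤ) :
    ‖mFourierCoeff g k‖ ≤ ∫ x, ‖g x‖ := by
  rw [FunctionSpaces.Torus.mFourierCoeff_eq_integral_volume]
  have h1 : ∀ x, ‖mFourier (-k) x • g x‖ ≤ ‖g x‖ := fun x => by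
    rw [norm_smul]
    exact mul_le_of_le_one_left (norm_nonneg _)
      (((mFourier (-k)).norm_coe_le_norm x).trans_eq mFourier_norm)
  exact (norm_integral_le_integral_norm _).trans
    (integral_mono_of_nonneg (ae_of_all _ fun x => norm_nonneg _) hg.norm (ae_of_all _ h1))

/-- **A uniform a.e. bound for the Fourier coefficients of the difference**: there is `B` with
`‖(û(s) - v̂(s))(k)‖ ≤ B` for a.e. `s ∈ (0,T)` and all `k`. [folklore] -/
theorem IsLerayHopfOn.exists_forall_norm_mFourierCoeff_sub_le (hu : IsLerayHopfOn T ν f u₀ u)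
    (hv : IsLerayHopfOn T ν f u₀ v) :
    ∃ B : ℝ, 0 ≤ B ∧ ∀ᵐ s ∂(volume.restrict (Ioo 0 T)), ∀ k : d → ℤ,
      ‖mFourierCoeff (FunctionSpaces.EuclideanSpace.complexify ∘ (u s - v s)) k‖ ≤ B := by
  obtain ⟨Cu, hCu0, hCu⟩ := hu.exists_integral_norm_sq_le
  obtain ⟨Cv, hCv0, hCv⟩ := hv.exists_integral_norm_sq_le
  refine ⟨2⁻¹ * (1 + (2 * Cu + 2 * Cv)), by positivity, ?_⟩
  filter_upwards [hCu, hCv, ae_restrict_mem measurableSet_Ioo] with s hsu hsv hs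
  intro k
  have hsI : s ∈ Icc 0 T := Ioo_subset_Icc_self hs
  have hmem : MemLp (u s - v s) 2 volume := (hu.memLp s hsI).sub (hv.memLp s hsI)
  have hsq : ∫ x, ‖(u s - v s) x‖ ^ 2 ≤ 2 * Cu + 2 * Cv := by
    have iu := (hu.memLp s hsI).integrable_norm_pow two_ne_zero
    have iv := (hv.memLp s hsI).integrable_norm_pow two_ne_zero
    calc ∫ x, ‖(u s - v s) x‖ ^ 2 ≤ ∫ x, (2 * ‖u s x‖ ^ 2 + 2 * ‖v s x‖ ^ 2) := by
          refine integral_mono (hmem.integrable_norm_pow two_ne_zero) ((iu.const_mul 2).add (iv.const_mul 2))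
            fun x => ?_
          simp only [Pi.sub_apply]
          nlinarith [mul_self_le_mul_self (norm_nonneg (u s x - v s x)) (norm_sub_le (u s x) (v s x)),
            sq_nonneg (‖u s x‖ - ‖v s x‖), norm_nonneg (u s x - v s x), norm_nonneg (u s x),
            norm_nonneg (v s x)]
      _ = 2 * (∫ x, ‖u s x‖ ^ 2) + 2 * ∫ x, ‖v s x‖ ^ 2 := by
          rw [integral_add (iu.const_mul 2) (iv.const_mul 2), integral_const_mul, integral_const_mul]
      _ ≤ 2 * Cu + 2 * Cv := by gcongr
  calc ‖mFourierCoeff (FunctionSpaces.EuclideanSpace.complexify ∘ (u s - v s)) k‖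
      ≤ ∫ x, ‖(FunctionSpaces.EuclideanSpace.complexify ∘ (u s - v s)) x‖ :=
        norm_mFourierCoeff_le_integral_norm
          (FunctionSpaces.Torus.integrable_complexify_comp (hmem.integrable one_le_two)) _
    _ = ∫ x, ‖(u s - v s) x‖ := by
        refine integral_congr_ae (ae_of_all _ fun x => ?_)
        simp only [comp_apply, FunctionSpaces.EuclideanSpace.norm_complexify]
    _ ≤ 2⁻¹ * (1 + ∫ x, ‖(u s - v s) x‖ ^ 2) := integral_norm_le_of_memLp_two hmem
    _ ≤ 2⁻¹ * (1 + (2 * Cu + 2 * Cv)) := by gcongr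

/-- The spectral dissipation of the truncated difference is integrable in time on `(0, T)`
(a finite sum of `|k|² ‖ŵ(s)(k)‖²`, each measurable and essentially bounded). [folklore] -/
theorem IsLerayHopfOn.integrableOn_toReal_eGradNormSq_fourierTruncate_sub (hu : IsLerayHopfOn T ν f u₀ u)
    (hv : IsLerayHopfOn T ν f u₀ v) (N : ℕ) :
    IntegrableOn (fun s => (FunctionSpaces.Torus.eGradNormSq
      (FunctionSpaces.Torus.fourierTruncate N (u s - v s))).toReal) (Ioo 0 T) := by
  obtain ⟨B, hB0, hB⟩ := hu.exists_forall_norm_mFourierCoeff_sub_le hv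
  set c : ℝ → (d → ℤ) → EuclideanSpace ℂ d := fun s k =>
    mFourierCoeff (FunctionSpaces.EuclideanSpace.complexify ∘ (u s - v s)) k with hc
  have hformula : ∀ s ∈ Ioo 0 T, (FunctionSpaces.Torus.eGradNormSq
      (FunctionSpaces.Torus.fourierTruncate N (u s - v s))).toReal =
      4 * Real.pi ^ 2 * ∑ k ∈ FunctionSpaces.Torus.freqBall N, FunctionSpaces.Torus.freqNormSq k * ‖c s k‖ ^ 2 := by
    intro s hs
    have hint : Integrable (u s - v s) volume :=
      ((hu.memLp s (Ioo_subset_Icc_self hs)).sub (hv.memLp s (Ioo_subset_Icc_self hs))).integrable one_le_two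
    rw [FunctionSpaces.Torus.fourierTruncate_eq,
      FunctionSpaces.Torus.toReal_eGradNormSq_realTrigPoly FunctionSpaces.Torus.neg_mem_freqBall_of_mem
        (FunctionSpaces.Torus.isConjSymm_mFourierCoeff hint)]
  have hmeas : ∀ k, AEStronglyMeasurable (fun s => FunctionSpaces.Torus.freqNormSq k * ‖c s k‖ ^ 2)
      (volume.restrict (Ioo 0 T)) := fun k =>
    (((hu.aestronglyMeasurable_mFourierCoeff_complexify_sub hv k).norm.pow 2).const_mul _)
  have : IsFiniteMeasure (volume.restrict (Ioo (0 : ℝ) T)) := ⟨by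
    rw [Measure.restrict_apply_univ]; exact measure_Ioo_lt_top⟩
  have hk : ∀ k, Integrable (fun s => FunctionSpaces.Torus.freqNormSq k * ‖c s k‖ ^ 2)
      (volume.restrict (Ioo 0 T)) := by
    intro k
    refine Integrable.mono' (integrable_const (FunctionSpaces.Torus.freqNormSq k * B ^ 2)) (hmeas k) ?_
    filter_upwards [hB] with s hs
    rw [Real.norm_of_nonneg (mul_nonneg (FunctionSpaces.Torus.freqNormSq_nonneg k) (sq_nonneg _))]
    exact mul_le_mul_of_nonneg_left (pow_le_pow_left₀ (norm_nonneg _) (hs k) 2)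
      (FunctionSpaces.Torus.freqNormSq_nonneg k)
  refine ((integrable_finsetSum (FunctionSpaces.Torus.freqBall N) fun k _ => hk k).const_mul
    (4 * Real.pi ^ 2)).congr ?_
  filter_upwards [ae_restrict_mem measurableSet_Ioo] with s hs
  exact (hformula s hs).symm

end Measurability

/-! ### The truncated balance as an `ℝ≥0∞` inequality, and the bound of its nonlinear term -/

section PerN

variable {T ν : ℝ} {f u v : ℝ → UnitAddTorus d → EuclideanSpace ℝ d}
  {u₀ : UnitAddTorus d → EuclideanSpace ℝ d}

/-- **The truncated balance in `ℝ≥0∞` form**: for `ν ≥ 0`, every `N` and every `t ∈ (0, T]`,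
`∫⁻‖P_N w(t)‖ₑ² + 2ν ∫⁻_{(0,t)} ‖∇P_N w‖₂² ≤ 2 ∫⁻_{(0,t)} ‖∫⟪u,(u·∇)P_N w⟫ - ∫⟪v,(v·∇)P_N w⟫‖ₑ`
(from the accepted real balance `Torus.IsLerayHopfOn.truncated_difference_balance`). [folklore] -/
theorem IsLerayHopfOn.truncated_difference_le (hu : IsLerayHopfOn T ν f u₀ u) (hv : IsLerayHopfOn T ν f u₀ v)
    (hν : 0 ≤ ν) (hT : 0 < T)
    (hfm : AEStronglyMeasurable (FunctionSpaces.Torus.stLift f) (volume.restrict (Ioo 0 T ×ˢ univ)))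
    (hf₂ : ∫⁻ t in Ioo 0 T, ∫⁻ x, ‖f t x‖ₑ ^ 2 < ∞) (N : ℕ) {t : ℝ} (ht : t ∈ Ioc 0 T) :
    (∫⁻ x, ‖FunctionSpaces.Torus.fourierTruncate N (u t - v t) x‖ₑ ^ 2) +
        2 * ENNReal.ofReal ν * ∫⁻ s in Ioo 0 t, FunctionSpaces.Torus.eGradNormSq
          (FunctionSpaces.Torus.fourierTruncate N (u s - v s)) ≤
      2 * ∫⁻ s in Ioo 0 t,
        ‖(∫ x, ⟪u s x, FunctionSpaces.Torus.convect (u s) (FunctionSpaces.Torus.fourierTruncate N (u s - v s)) x⟫) -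
          ∫ x, ⟪v s x, FunctionSpaces.Torus.convect (v s) (FunctionSpaces.Torus.fourierTruncate N (u s - v s)) x⟫‖ₑ := by
  have hbal := hu.truncated_difference_balance hv hT hfm hf₂ N ht
  set A : ℝ := ∫ x, ‖FunctionSpaces.Torus.fourierTruncate N (u t - v t) x‖ ^ 2 with hA
  set B : ℝ := ∫ s in Ioc 0 t, (FunctionSpaces.Torus.eGradNormSq
    (FunctionSpaces.Torus.fourierTruncate N (u s - v s))).toReal with hB
  set C : ℝ := ∫ s in Ioc 0 t,
    ((∫ x, ⟪u s x, FunctionSpaces.Torus.convect (u s) (FunctionSpaces.Torus.fourierTruncate N (u s - v s)) x⟫) -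
      ∫ x, ⟪v s x, FunctionSpaces.Torus.convect (v s) (FunctionSpaces.Torus.fourierTruncate N (u s - v s)) x⟫) with hC
  have hA0 : 0 ≤ A := integral_nonneg fun x => sq_nonneg _
  have hB0 : 0 ≤ B := setIntegral_nonneg measurableSet_Ioc fun s _ => ENNReal.toReal_nonneg
  -- `ofReal A`
  have hA' : ENNReal.ofReal A = ∫⁻ x, ‖FunctionSpaces.Torus.fourierTruncate N (u t - v t) x‖ₑ ^ 2 :=
    (Torus.lintegral_enorm_sq_eq_ofReal (FunctionSpaces.Torus.memLp_fourierTruncate N _ 2)).symm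
  -- `ofReal B`
  have hDint : IntegrableOn (fun s => (FunctionSpaces.Torus.eGradNormSq
      (FunctionSpaces.Torus.fourierTruncate N (u s - v s))).toReal) (Ioc 0 t) :=
    (integrableOn_Ioc_iff_integrableOn_Ioo (μ := volume)).2
      ((hu.integrableOn_toReal_eGradNormSq_fourierTruncate_sub hv N).mono_set (Ioo_subset_Ioo le_rfl ht.2))
  have hB' : ENNReal.ofReal B = ∫⁻ s in Ioo 0 t, FunctionSpaces.Torus.eGradNormSq
      (FunctionSpaces.Torus.fourierTruncate N (u s - v s)) := by
    rw [hB, ofReal_integral_eq_lintegral_ofReal hDint (ae_of_all _ fun s => ENNReal.toReal_nonneg),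
      setLIntegral_congr Ioo_ae_eq_Ioc.symm]
    refine lintegral_congr fun s => ?_
    exact ENNReal.ofReal_toReal (FunctionSpaces.Torus.eGradNormSq_lt_top
      (FunctionSpaces.Torus.isSmooth_fourierTruncate N _)).ne
  -- `ofReal (2C)`
  have hC' : ENNReal.ofReal (2 * C) ≤ 2 * ∫⁻ s in Ioo 0 t,
      ‖(∫ x, ⟪u s x, FunctionSpaces.Torus.convect (u s) (FunctionSpaces.Torus.fourierTruncate N (u s - v s)) x⟫) -
        ∫ x, ⟪v s x, FunctionSpaces.Torus.convect (v s) (FunctionSpaces.Torus.fourierTruncate N (u s - v s)) x⟫‖ₑ := by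
    rw [ENNReal.ofReal_mul zero_le_two, ENNReal.ofReal_ofNat, ← setLIntegral_congr Ioo_ae_eq_Ioc.symm]
    refine mul_le_mul' le_rfl ?_
    calc ENNReal.ofReal C ≤ ‖C‖ₑ := by
          rw [Real.enorm_eq_ofReal_abs]; exact ENNReal.ofReal_le_ofReal (le_abs_self C)
      _ ≤ _ := enorm_integral_le_lintegral_enorm _
  calc (∫⁻ x, ‖FunctionSpaces.Torus.fourierTruncate N (u t - v t) x‖ₑ ^ 2) +
        2 * ENNReal.ofReal ν * ∫⁻ s in Ioo 0 t, FunctionSpaces.Torus.eGradNormSq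
          (FunctionSpaces.Torus.fourierTruncate N (u s - v s))
      = ENNReal.ofReal (A + 2 * ν * B) := by
        rw [ENNReal.ofReal_add hA0 (by positivity), ENNReal.ofReal_mul (by positivity),
          ENNReal.ofReal_mul zero_le_two, ENNReal.ofReal_ofNat, hA', hB']
    _ = ENNReal.ofReal (2 * C) := by rw [hbal]
    _ ≤ _ := hC'

/-- **The nonlinear term of the truncated balance, bounded in time**: for every `t ∈ (0, T]`,
`∫⁻_{(0,t)} ‖∫⟪u,(u·∇)P_N w⟫ - ∫⟪v,(v·∇)P_N w⟫‖ₑ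
  ≤ ∫⁻_{(0,t)} ( ‖v‖₄‖w‖₄‖∇w‖₂ + ‖P_N w - w‖₄ (‖v‖₄ + ‖w‖₄) ‖∇w‖₂ )`
(`Torus.enorm_trilinear_sub_le` slice by slice, with `‖∇P_N w‖₂ ≤ ‖∇w‖₂`; Kuksin–Shirikyan 2012,
proof of Thm. 2.1.13). [cite: KuksinShirikyan2012, Thm. 2.1.13 (proof)] -/
theorem IsLerayHopfOn.lintegral_enorm_trilinear_sub_le (hu : IsLerayHopfOn T ν f u₀ u)
    (hv : IsLerayHopfOn T ν f u₀ v) (N : ℕ) {t : ℝ} (ht : t ∈ Ioc 0 T) :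
    ∫⁻ s in Ioo 0 t,
        ‖(∫ x, ⟪u s x, FunctionSpaces.Torus.convect (u s) (FunctionSpaces.Torus.fourierTruncate N (u s - v s)) x⟫) -
          ∫ x, ⟪v s x, FunctionSpaces.Torus.convect (v s) (FunctionSpaces.Torus.fourierTruncate N (u s - v s)) x⟫‖ₑ ≤
      ∫⁻ s in Ioo 0 t,
        ((∫⁻ x, ‖v s x‖ₑ ^ 4) ^ (1 / 4 : ℝ) * (∫⁻ x, ‖u s x - v s x‖ₑ ^ 4) ^ (1 / 4 : ℝ) *
            FunctionSpaces.Torus.eGradNormSq (u s - v s) ^ (1 / 2 : ℝ) +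
          (∫⁻ x, ‖FunctionSpaces.Torus.fourierTruncate N (u s - v s) x - (u s - v s) x‖ₑ ^ 4) ^ (1 / 4 : ℝ) *
            ((∫⁻ x, ‖v s x‖ₑ ^ 4) ^ (1 / 4 : ℝ) + (∫⁻ x, ‖u s x - v s x‖ₑ ^ 4) ^ (1 / 4 : ℝ)) *
            FunctionSpaces.Torus.eGradNormSq (u s - v s) ^ (1 / 2 : ℝ)) := by
  refine setLIntegral_mono' measurableSet_Ioo fun s hs => ?_
  have hsT : s ∈ Ioc 0 T := ⟨hs.1, hs.2.le.trans ht.2⟩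
  have hsI : s ∈ Icc 0 T := Ioc_subset_Icc_self hsT
  have hmu := hu.memLp s hsI
  have hmv := hv.memLp s hsI
  have hint : Integrable (u s - v s) volume := (hmu.sub hmv).integrable one_le_two
  have hVdiv := hv.isWeaklyDivFree_of_mem_Ioc hsT
  have hWdiv : FunctionSpaces.Torus.IsWeaklyDivFree (u s - v s) :=
    IsWeaklyDivFree.sub' (hu.isWeaklyDivFree_of_mem_Ioc hsT) hVdiv (hmu.integrable one_le_two)
      (hmv.integrable one_le_two)
  have h := enorm_trilinear_sub_le hmu hmv hVdiv hWdiv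
    (FunctionSpaces.Torus.isSmooth_fourierTruncate N (u s - v s))
  refine h.trans ?_
  have hG : FunctionSpaces.Torus.eGradNormSq (FunctionSpaces.Torus.fourierTruncate N (u s - v s)) ^ (1 / 2 : ℝ) ≤
      FunctionSpaces.Torus.eGradNormSq (u s - v s) ^ (1 / 2 : ℝ) :=
    ENNReal.rpow_le_rpow (Torus.eGradNormSq_fourierTruncate_le hint N) (by norm_num)
  have hR : (∫⁻ x, ‖(u s - v s) x - FunctionSpaces.Torus.fourierTruncate N (u s - v s) x‖ₑ ^ 4) =
      ∫⁻ x, ‖FunctionSpaces.Torus.fourierTruncate N (u s - v s) x - (u s - v s) x‖ₑ ^ 4 :=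
    lintegral_congr fun x => by rw [enorm_sub_rev]
  rw [hR]
  simp only [Pi.sub_apply]
  gcongr

end PerN

/-! ### Two dimensions: `L⁴` integrability in time and the vanishing of the truncation error -/

section TwoD

variable {T ν : ℝ} {f u v : ℝ → UnitAddTorus (Fin 2) → EuclideanSpace ℝ (Fin 2)}
  {u₀ : UnitAddTorus (Fin 2) → EuclideanSpace ℝ (Fin 2)}

/-- **`∫₀ᵀ ‖u(s)‖₄⁴ ds < ∞` for a Leray–Hopf solution on `𝕋²`** (Ladyzhenskaya's inequality
slice by slice, `‖u(s)‖₄⁴ ≤ C |u(s)|² (|u(s)|² + ‖∇u(s)‖²)`, with `|u(s)|²` bounded on `[0,T]` and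
`∫₀ᵀ‖∇u‖² < ∞`; Kuksin–Shirikyan 2012, proof of Prop. 2.1.9: "`ℋ ⊂ L⁴(0,T;H^{1/2})`").
[cite: KuksinShirikyan2012, Prop. 2.1.9 (proof)] -/
theorem IsLerayHopfOn.lintegral_lintegral_enorm_pow_four_lt_top (hu : IsLerayHopfOn T ν f u₀ u)
    (hν : 0 ≤ ν)
    (hfm : AEStronglyMeasurable (FunctionSpaces.Torus.stLift f) (volume.restrict (Ioo 0 T ×ˢ univ)))
    (hf₂ : ∫⁻ t in Ioo 0 T, ∫⁻ x, ‖f t x‖ₑ ^ 2 < ∞) :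
    ∫⁻ s in Ioo 0 T, ∫⁻ x, ‖u s x‖ₑ ^ 4 < ∞ := by
  obtain ⟨C, hC, hLad⟩ := exists_ladyzhenskaya_const_memLp
  obtain ⟨M, hM, hMle⟩ := hu.exists_forall_lintegral_enorm_sq_le hν hfm hf₂
  have hpt : ∀ s ∈ Ioo 0 T, ∫⁻ x, ‖u s x‖ₑ ^ 4 ≤ C * (M * (M + FunctionSpaces.Torus.eGradNormSq (u s))) := by
    intro s hs
    have h := hLad (u s) (hu.memLp s (Ioo_subset_Icc_self hs))
    have hY := hMle s (Ioo_subset_Icc_self hs)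
    exact h.trans (by gcongr)
  calc ∫⁻ s in Ioo 0 T, ∫⁻ x, ‖u s x‖ₑ ^ 4
      ≤ ∫⁻ s in Ioo 0 T, C * (M * (M + FunctionSpaces.Torus.eGradNormSq (u s))) :=
        setLIntegral_mono' measurableSet_Ioo hpt
    _ = C * (M * ((∫⁻ _ in Ioo 0 T, M) + ∫⁻ s in Ioo 0 T, FunctionSpaces.Torus.eGradNormSq (u s))) := by
        rw [lintegral_const_mul' _ _ hC, lintegral_const_mul' _ _ hM, lintegral_add_left' aemeasurable_const]
    _ < ∞ := by
        rw [setLIntegral_const]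
        exact ENNReal.mul_lt_top hC.lt_top (ENNReal.mul_lt_top hM.lt_top (ENNReal.add_lt_top.2
          ⟨ENNReal.mul_lt_top hM.lt_top measure_Ioo_lt_top, hu.lintegral_eGradNormSq_lt_top⟩))

/-- `∫₀ᵀ ‖u(s) - v(s)‖₄⁴ ds < ∞` for two Leray–Hopf solutions on `𝕋²`
(`‖a - b‖⁴ ≤ 16 (‖a‖⁴ + ‖b‖⁴)`). [folklore] -/
theorem IsLerayHopfOn.lintegral_lintegral_enorm_pow_four_sub_lt_top (hu : IsLerayHopfOn T ν f u₀ u)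
    (hv : IsLerayHopfOn T ν f u₀ v) (hν : 0 ≤ ν)
    (hfm : AEStronglyMeasurable (FunctionSpaces.Torus.stLift f) (volume.restrict (Ioo 0 T ×ˢ univ)))
    (hf₂ : ∫⁻ t in Ioo 0 T, ∫⁻ x, ‖f t x‖ₑ ^ 2 < ∞) :
    ∫⁻ s in Ioo 0 T, ∫⁻ x, ‖u s x - v s x‖ₑ ^ 4 < ∞ := by
  have hpt : ∀ s ∈ Ioo 0 T, ∫⁻ x, ‖u s x - v s x‖ₑ ^ 4 ≤ 16 * ((∫⁻ x, ‖u s x‖ₑ ^ 4) + ∫⁻ x, ‖v s x‖ₑ ^ 4) := by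
    intro s hs
    have hsI : ∀ x, ‖u s x - v s x‖ₑ ^ 4 ≤ 16 * (‖u s x‖ₑ ^ 4 + ‖v s x‖ₑ ^ 4) := by
      intro x
      have h1 : ‖u s x - v s x‖ₑ ≤ 2 * max ‖u s x‖ₑ ‖v s x‖ₑ :=
        enorm_sub_le.trans (by
          rw [two_mul]; exact add_le_add (le_max_left _ _) (le_max_right _ _))
      have h2 : max ‖u s x‖ₑ ‖v s x‖ₑ ^ 4 ≤ ‖u s x‖ₑ ^ 4 + ‖v s x‖ₑ ^ 4 := by
        rcases le_total ‖u s x‖ₑ ‖v s x‖ₑ with h | h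
        · rw [max_eq_right h]; exact le_add_self
        · rw [max_eq_left h]; exact le_self_add
      calc ‖u s x - v s x‖ₑ ^ 4 ≤ (2 * max ‖u s x‖ₑ ‖v s x‖ₑ) ^ 4 := pow_le_pow_left₀ zero_le h1 4
        _ = 16 * max ‖u s x‖ₑ ‖v s x‖ₑ ^ 4 := by ring
        _ ≤ _ := by gcongr
    have hm : AEMeasurable (fun x => ‖u s x‖ₑ ^ 4) volume :=
      (hu.memLp s (Ioo_subset_Icc_self hs)).1.aemeasurable.enorm.pow_const 4
    calc ∫⁻ x, ‖u s x - v s x‖ₑ ^ 4 ≤ ∫⁻ x, 16 * (‖u s x‖ₑ ^ 4 + ‖v s x‖ₑ ^ 4) := lintegral_mono hsI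
      _ = 16 * ((∫⁻ x, ‖u s x‖ₑ ^ 4) + ∫⁻ x, ‖v s x‖ₑ ^ 4) := by
          rw [lintegral_const_mul' _ _ ENNReal.ofNat_ne_top, lintegral_add_left' hm]
  calc ∫⁻ s in Ioo 0 T, ∫⁻ x, ‖u s x - v s x‖ₑ ^ 4
      ≤ ∫⁻ s in Ioo 0 T, 16 * ((∫⁻ x, ‖u s x‖ₑ ^ 4) + ∫⁻ x, ‖v s x‖ₑ ^ 4) :=
        setLIntegral_mono' measurableSet_Ioo hpt
    _ = 16 * ((∫⁻ s in Ioo 0 T, ∫⁻ x, ‖u s x‖ₑ ^ 4) + ∫⁻ s in Ioo 0 T, ∫⁻ x, ‖v s x‖ₑ ^ 4) := by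
        rw [lintegral_const_mul' _ _ ENNReal.ofNat_ne_top,
          lintegral_add_left' (hu.aemeasurable_lintegral_enorm_pow 4)]
    _ < ∞ := ENNReal.mul_lt_top ENNReal.ofNat_lt_top (ENNReal.add_lt_top.2
        ⟨hu.lintegral_lintegral_enorm_pow_four_lt_top hν hfm hf₂,
          hv.lintegral_lintegral_enorm_pow_four_lt_top hν hfm hf₂⟩)


/-- Finite dissipation of the difference in time: `∫₀ᵀ ‖∇(u - v)‖₂² < ∞`
(`‖∇(u-v)‖² ≤ 2‖∇u‖² + 2‖∇v‖²`). [folklore] -/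
theorem IsLerayHopfOn.lintegral_eGradNormSq_sub_lt_top (hu : IsLerayHopfOn T ν f u₀ u)
    (hv : IsLerayHopfOn T ν f u₀ v) :
    ∫⁻ s in Ioo 0 T, FunctionSpaces.Torus.eGradNormSq (u s - v s) < ∞ := by
  have hle : ∀ s ∈ Ioo 0 T, FunctionSpaces.Torus.eGradNormSq (u s - v s) ≤
      2 * FunctionSpaces.Torus.eGradNormSq (u s) + 2 * FunctionSpaces.Torus.eGradNormSq (v s) := fun s hs =>
    Torus.eGradNormSq_sub_le ((hu.memLp s (Ioo_subset_Icc_self hs)).integrable one_le_two)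
      ((hv.memLp s (Ioo_subset_Icc_self hs)).integrable one_le_two)
  calc ∫⁻ s in Ioo 0 T, FunctionSpaces.Torus.eGradNormSq (u s - v s)
      ≤ ∫⁻ s in Ioo 0 T, (2 * FunctionSpaces.Torus.eGradNormSq (u s) + 2 * FunctionSpaces.Torus.eGradNormSq (v s)) :=
        setLIntegral_mono' measurableSet_Ioo hle
    _ = 2 * (∫⁻ s in Ioo 0 T, FunctionSpaces.Torus.eGradNormSq (u s)) +
        2 * ∫⁻ s in Ioo 0 T, FunctionSpaces.Torus.eGradNormSq (v s) := by
        rw [lintegral_add_left' (hu.aemeasurable_eGradNormSq.const_mul _),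
          lintegral_const_mul' _ _ ENNReal.ofNat_ne_top, lintegral_const_mul' _ _ ENNReal.ofNat_ne_top]
    _ < ∞ := ENNReal.add_lt_top.2 ⟨ENNReal.mul_lt_top ENNReal.ofNat_lt_top hu.lintegral_eGradNormSq_lt_top,
        ENNReal.mul_lt_top ENNReal.ofNat_lt_top hv.lintegral_eGradNormSq_lt_top⟩

/-- **The `L⁴` truncation error vanishes in time on `𝕋²`**:
`∫₀ᵀ ∫ ‖P_N w(s) - w(s)‖⁴ ds → 0` as `N → ∞` for the difference `w = u - v` of two Leray–Hopf
solutions — dominated convergence in time of the slice convergence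
`tendsto_lintegral_enorm_pow_four_fourierTruncate_sub` (valid where `‖∇w(s)‖₂ < ∞`, i.e. for a.e.
`s`), with the Ladyzhenskaya domination `∫‖P_N w - w‖⁴ ≤ C |w|² (|w|² + ‖∇w‖²)`. [folklore] -/
theorem IsLerayHopfOn.tendsto_lintegral_lintegral_enorm_pow_four_fourierTruncate_sub (hu : IsLerayHopfOn T ν f u₀ u)
    (hv : IsLerayHopfOn T ν f u₀ v) (hν : 0 ≤ ν)
    (hfm : AEStronglyMeasurable (FunctionSpaces.Torus.stLift f) (volume.restrict (Ioo 0 T ×ˢ univ)))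
    (hf₂ : ∫⁻ t in Ioo 0 T, ∫⁻ x, ‖f t x‖ₑ ^ 2 < ∞) :
    Tendsto (fun N => ∫⁻ s in Ioo 0 T,
      ∫⁻ x, ‖FunctionSpaces.Torus.fourierTruncate N (u s - v s) x - (u s - v s) x‖ₑ ^ 4) atTop (𝓝 0) := by
  obtain ⟨C, hC, hLad⟩ := exists_ladyzhenskaya_const_memLp
  obtain ⟨Mu, hMu, hMule⟩ := hu.exists_forall_lintegral_enorm_sq_le hν hfm hf₂
  obtain ⟨Mv, hMv, hMvle⟩ := hv.exists_forall_lintegral_enorm_sq_le hν hfm hf₂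
  set M : ℝ≥0∞ := 2 * Mu + 2 * Mv with hM
  have hMtop : M ≠ ∞ := ENNReal.add_ne_top.2
    ⟨ENNReal.mul_ne_top ENNReal.ofNat_ne_top hMu, ENNReal.mul_ne_top ENNReal.ofNat_ne_top hMv⟩
  set g : ℝ → ℝ≥0∞ := fun s => FunctionSpaces.Torus.eGradNormSq (u s - v s) with hg
  -- `|w(s)|² ≤ M` on `[0, T]`
  have hY : ∀ s ∈ Icc 0 T, ∫⁻ x, ‖(u s - v s) x‖ₑ ^ 2 ≤ M := by
    intro s hs
    have hm : AEMeasurable (fun x => ‖u s x‖ₑ ^ 2) volume := (hu.memLp s hs).1.aemeasurable.enorm.pow_const 2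
    calc ∫⁻ x, ‖(u s - v s) x‖ₑ ^ 2 ≤ ∫⁻ x, (2 * ‖u s x‖ₑ ^ 2 + 2 * ‖v s x‖ₑ ^ 2) :=
          lintegral_mono fun x => enorm_sub_sq_le_two_mul _ _
      _ = 2 * (∫⁻ x, ‖u s x‖ₑ ^ 2) + 2 * ∫⁻ x, ‖v s x‖ₑ ^ 2 := by
          rw [lintegral_add_left' (hm.const_mul _), lintegral_const_mul' _ _ ENNReal.ofNat_ne_top,
            lintegral_const_mul' _ _ ENNReal.ofNat_ne_top]
      _ ≤ M := by rw [hM]; gcongr <;> [exact hMule s hs; exact hMvle s hs]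
  -- domination
  set bound : ℝ → ℝ≥0∞ := fun s => C * (M * (M + g s)) with hbound
  have h_bound : ∀ N, ∀ᵐ s ∂(volume.restrict (Ioo 0 T)),
      (∫⁻ x, ‖FunctionSpaces.Torus.fourierTruncate N (u s - v s) x - (u s - v s) x‖ₑ ^ 4) ≤ bound s := by
    intro N
    filter_upwards [ae_restrict_mem measurableSet_Ioo] with s hs
    have hsI : s ∈ Icc 0 T := Ioo_subset_Icc_self hs
    have hmem : MemLp (u s - v s) 2 volume := (hu.memLp s hsI).sub (hv.memLp s hsI)
    have hint : Integrable (u s - v s) volume := hmem.integrable one_le_two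
    have h := hLad (FunctionSpaces.Torus.fourierTruncate N (u s - v s) - (u s - v s))
      ((FunctionSpaces.Torus.memLp_fourierTruncate N _ 2).sub hmem)
    refine h.trans ?_
    have h1 : (∫⁻ x, ‖(FunctionSpaces.Torus.fourierTruncate N (u s - v s) - (u s - v s)) x‖ₑ ^ 2) ≤ M :=
      (lintegral_enorm_sq_fourierTruncate_sub_le' hmem N).trans (hY s hsI)
    have h2 : FunctionSpaces.Torus.eGradNormSq (FunctionSpaces.Torus.fourierTruncate N (u s - v s) - (u s - v s)) ≤ g s :=
      eGradNormSq_fourierTruncate_sub_le hint N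
    exact mul_le_mul' le_rfl (mul_le_mul' h1 (add_le_add h1 h2))
  -- finiteness of the dominating function
  have h_fin : ∫⁻ s in Ioo 0 T, bound s ≠ ∞ := by
    rw [hbound, lintegral_const_mul' _ _ hC, lintegral_const_mul' _ _ hMtop, lintegral_add_left' aemeasurable_const,
      setLIntegral_const]
    exact ENNReal.mul_ne_top hC (ENNReal.mul_ne_top hMtop (ENNReal.add_ne_top.2
      ⟨ENNReal.mul_ne_top hMtop measure_Ioo_lt_top.ne, (hu.lintegral_eGradNormSq_sub_lt_top hv).ne⟩))
  -- slice convergence for a.e. time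
  have h_lim : ∀ᵐ s ∂(volume.restrict (Ioo 0 T)), Tendsto (fun N =>
      ∫⁻ x, ‖FunctionSpaces.Torus.fourierTruncate N (u s - v s) x - (u s - v s) x‖ₑ ^ 4) atTop (𝓝 0) := by
    filter_upwards [ae_lt_top' (hu.aemeasurable_eGradNormSq_sub hv) (hu.lintegral_eGradNormSq_sub_lt_top hv).ne,
      ae_restrict_mem measurableSet_Ioo] with s hgs hs
    exact tendsto_lintegral_enorm_pow_four_fourierTruncate_sub
      ((hu.memLp s (Ioo_subset_Icc_self hs)).sub (hv.memLp s (Ioo_subset_Icc_self hs))) hgs.ne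
  have h := tendsto_lintegral_of_dominated_convergence' bound
    (fun N => hu.aemeasurable_lintegral_enorm_pow_four_fourierTruncate_sub hv N) h_bound h_fin h_lim
  simpa only [lintegral_zero] using h

/-- **The Hölder-conjugate weight is integrable**: with `A(s) = ‖v(s)‖₄`, `B(s) = ‖w(s)‖₄`,
`H(s) = (A + B) ‖∇w(s)‖₂`, one has `∫₀ᵀ H^{4/3} < ∞` on `𝕋²`
(`H^{4/3} ≤ (A+B)⁴ + ‖∇w‖₂²` by Young `(3, 3/2)`, `(A+B)⁴ ≤ 16(A⁴ + B⁴)`). [folklore] -/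
theorem IsLerayHopfOn.lintegral_holderWeight_lt_top (hu : IsLerayHopfOn T ν f u₀ u)
    (hv : IsLerayHopfOn T ν f u₀ v) (hν : 0 ≤ ν)
    (hfm : AEStronglyMeasurable (FunctionSpaces.Torus.stLift f) (volume.restrict (Ioo 0 T ×ˢ univ)))
    (hf₂ : ∫⁻ t in Ioo 0 T, ∫⁻ x, ‖f t x‖ₑ ^ 2 < ∞) :
    ∫⁻ s in Ioo 0 T, (((∫⁻ x, ‖v s x‖ₑ ^ 4) ^ (1 / 4 : ℝ) + (∫⁻ x, ‖u s x - v s x‖ₑ ^ 4) ^ (1 / 4 : ℝ)) *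
        FunctionSpaces.Torus.eGradNormSq (u s - v s) ^ (1 / 2 : ℝ)) ^ (4 / 3 : ℝ) < ∞ := by
  have hpt : ∀ s, (((∫⁻ x, ‖v s x‖ₑ ^ 4) ^ (1 / 4 : ℝ) + (∫⁻ x, ‖u s x - v s x‖ₑ ^ 4) ^ (1 / 4 : ℝ)) *
        FunctionSpaces.Torus.eGradNormSq (u s - v s) ^ (1 / 2 : ℝ)) ^ (4 / 3 : ℝ) ≤
      16 * ((∫⁻ x, ‖v s x‖ₑ ^ 4) + ∫⁻ x, ‖u s x - v s x‖ₑ ^ 4) + FunctionSpaces.Torus.eGradNormSq (u s - v s) := by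
    intro s
    set A : ℝ≥0∞ := (∫⁻ x, ‖v s x‖ₑ ^ 4) ^ (1 / 4 : ℝ) with hA
    set B : ℝ≥0∞ := (∫⁻ x, ‖u s x - v s x‖ₑ ^ 4) ^ (1 / 4 : ℝ) with hB
    set G : ℝ≥0∞ := FunctionSpaces.Torus.eGradNormSq (u s - v s) with hG
    have hA4 : A ^ (4 : ℝ) = ∫⁻ x, ‖v s x‖ₑ ^ 4 := by
      rw [hA, ← ENNReal.rpow_mul]; norm_num
    have hB4 : B ^ (4 : ℝ) = ∫⁻ x, ‖u s x - v s x‖ₑ ^ 4 := by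
      rw [hB, ← ENNReal.rpow_mul]; norm_num
    -- Young with exponents `3` and `3/2`
    have hpq : (3 : ℝ).HolderConjugate (3 / 2) := by rw [Real.holderConjugate_iff]; norm_num
    have hY := ENNReal.young_inequality ((A + B) ^ (4 / 3 : ℝ)) (G ^ (2 / 3 : ℝ)) hpq
    have e1 : ((A + B) * G ^ (1 / 2 : ℝ)) ^ (4 / 3 : ℝ) = (A + B) ^ (4 / 3 : ℝ) * G ^ (2 / 3 : ℝ) := by
      rw [ENNReal.mul_rpow_of_nonneg _ _ (by norm_num), ← ENNReal.rpow_mul]; norm_num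
    have e2 : ((A + B) ^ (4 / 3 : ℝ)) ^ (3 : ℝ) = (A + B) ^ (4 : ℝ) := by
      rw [← ENNReal.rpow_mul]; norm_num
    have e3 : (G ^ (2 / 3 : ℝ)) ^ (3 / 2 : ℝ) = G := by
      rw [← ENNReal.rpow_mul]; norm_num
    have hsum : (A + B) ^ (4 : ℝ) ≤ 16 * (A ^ (4 : ℝ) + B ^ (4 : ℝ)) := by
      have h1 : A + B ≤ 2 * max A B := by
        rw [two_mul]; exact add_le_add (le_max_left _ _) (le_max_right _ _)
      have h2 : max A B ^ (4 : ℝ) ≤ A ^ (4 : ℝ) + B ^ (4 : ℝ) := by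
        rcases le_total A B with h | h
        · rw [max_eq_right h]; exact le_add_self
        · rw [max_eq_left h]; exact le_self_add
      calc (A + B) ^ (4 : ℝ) ≤ (2 * max A B) ^ (4 : ℝ) := ENNReal.rpow_le_rpow h1 (by norm_num)
        _ = 16 * max A B ^ (4 : ℝ) := by
            rw [ENNReal.mul_rpow_of_nonneg _ _ (by norm_num)]
            congr 1
            rw [show (4 : ℝ) = (4 : ℕ) by norm_num, ENNReal.rpow_natCast]
            norm_num
        _ ≤ 16 * (A ^ (4 : ℝ) + B ^ (4 : ℝ)) := by gcongr
    calc ((A + B) * G ^ (1 / 2 : ℝ)) ^ (4 / 3 : ℝ) = (A + B) ^ (4 / 3 : ℝ) * G ^ (2 / 3 : ℝ) := e1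
      _ ≤ ((A + B) ^ (4 / 3 : ℝ)) ^ (3 : ℝ) / ENNReal.ofReal 3 +
          (G ^ (2 / 3 : ℝ)) ^ (3 / 2 : ℝ) / ENNReal.ofReal (3 / 2) := hY
      _ ≤ ((A + B) ^ (4 / 3 : ℝ)) ^ (3 : ℝ) + (G ^ (2 / 3 : ℝ)) ^ (3 / 2 : ℝ) := by
          gcongr
          · refine ENNReal.div_le_of_le_mul (le_mul_of_one_le_right bot_le ?_)
            rw [← ENNReal.ofReal_one]; exact ENNReal.ofReal_le_ofReal (by norm_num)
          · refine ENNReal.div_le_of_le_mul (le_mul_of_one_le_right bot_le ?_)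
            rw [← ENNReal.ofReal_one]; exact ENNReal.ofReal_le_ofReal (by norm_num)
      _ = (A + B) ^ (4 : ℝ) + G := by rw [e2, e3]
      _ ≤ 16 * (A ^ (4 : ℝ) + B ^ (4 : ℝ)) + G := by gcongr
      _ = _ := by rw [hA4, hB4]
  calc ∫⁻ s in Ioo 0 T, (((∫⁻ x, ‖v s x‖ₑ ^ 4) ^ (1 / 4 : ℝ) + (∫⁻ x, ‖u s x - v s x‖ₑ ^ 4) ^ (1 / 4 : ℝ)) *
        FunctionSpaces.Torus.eGradNormSq (u s - v s) ^ (1 / 2 : ℝ)) ^ (4 / 3 : ℝ)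
      ≤ ∫⁻ s in Ioo 0 T, (16 * ((∫⁻ x, ‖v s x‖ₑ ^ 4) + ∫⁻ x, ‖u s x - v s x‖ₑ ^ 4) +
          FunctionSpaces.Torus.eGradNormSq (u s - v s)) := lintegral_mono fun s => hpt s
    _ = 16 * ((∫⁻ s in Ioo 0 T, ∫⁻ x, ‖v s x‖ₑ ^ 4) + ∫⁻ s in Ioo 0 T, ∫⁻ x, ‖u s x - v s x‖ₑ ^ 4) +
          ∫⁻ s in Ioo 0 T, FunctionSpaces.Torus.eGradNormSq (u s - v s) := by
        have hm1 : AEMeasurable (fun s => ∫⁻ x, ‖v s x‖ₑ ^ 4) (volume.restrict (Ioo 0 T)) :=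
          hv.aemeasurable_lintegral_enorm_pow 4
        have hm2 : AEMeasurable (fun s => ∫⁻ x, ‖u s x - v s x‖ₑ ^ 4) (volume.restrict (Ioo 0 T)) :=
          hu.aemeasurable_lintegral_enorm_pow_sub hv 4
        have hm12 : AEMeasurable (fun s => 16 * ((∫⁻ x, ‖v s x‖ₑ ^ 4) + ∫⁻ x, ‖u s x - v s x‖ₑ ^ 4))
            (volume.restrict (Ioo 0 T)) := (hm1.add hm2).const_mul _
        rw [lintegral_add_left' hm12, lintegral_const_mul' _ _ ENNReal.ofNat_ne_top,
          lintegral_add_left' hm1]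
    _ < ∞ := ENNReal.add_lt_top.2 ⟨ENNReal.mul_lt_top ENNReal.ofNat_lt_top (ENNReal.add_lt_top.2
        ⟨hv.lintegral_lintegral_enorm_pow_four_lt_top hν hfm hf₂,
          hu.lintegral_lintegral_enorm_pow_four_sub_lt_top hv hν hfm hf₂⟩),
        hu.lintegral_eGradNormSq_sub_lt_top hv⟩

end TwoD


end Torus

/-! ### The discharges -/

/-- **Discharge of `lions_prodi_difference_ineq_torus2`** (the energy inequality for the
difference of two Leray–Hopf solutions on `𝕋²`; Constantin–Foias 1988, proof of Thm. 10.1,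
(10.3)–(10.5); Kuksin–Shirikyan 2012, proof of Thm. 2.1.13): the accepted truncated balance
(`Torus.IsLerayHopfOn.truncated_difference_balance`) in `ℝ≥0∞` form, the bound of its nonlinear term
(`Torus.IsLerayHopfOn.lintegral_enorm_trilinear_sub_le`), and the limit `N → ∞`: finite Parseval
and monotone convergence on the left, Hölder `(4, 4/3)` in time and the vanishing of
`∫₀ᵀ‖P_N w - w‖₄⁴` on the error. [cite: ConstantinFoias1988, Thm. 10.1 (proof, (10.3)–(10.5))] -/
theorem lions_prodi_difference_ineq_torus2_holds : lions_prodi_difference_ineq_torus2 := by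
  intro ν T hν hT f hfm hf₂ u₀ hu₀ hdiv u v hu hv t ht
  have ht' : t ∈ Icc 0 T := ⟨ht.1.le, ht.2⟩
  set μt : Measure ℝ := volume.restrict (Ioo 0 t) with hμt
  have hsub : Ioo 0 t ⊆ Ioo 0 T := Ioo_subset_Ioo le_rfl ht.2
  have hle : μt ≤ volume.restrict (Ioo 0 T) := Measure.restrict_mono hsub le_rfl
  -- ### the time densities
  set g : ℝ → ℝ≥0∞ := fun s => FunctionSpaces.Torus.eGradNormSq (u s - v s) with hg
  set V4 : ℝ → ℝ≥0∞ := fun s => ∫⁻ x, ‖v s x‖ₑ ^ 4 with hV4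
  set W4 : ℝ → ℝ≥0∞ := fun s => ∫⁻ x, ‖u s x - v s x‖ₑ ^ 4 with hW4
  set R4 : ℕ → ℝ → ℝ≥0∞ := fun N s =>
    ∫⁻ x, ‖FunctionSpaces.Torus.fourierTruncate N (u s - v s) x - (u s - v s) x‖ₑ ^ 4 with hR4
  set G : ℕ → ℝ → ℝ≥0∞ := fun N s =>
    FunctionSpaces.Torus.eGradNormSq (FunctionSpaces.Torus.fourierTruncate N (u s - v s)) with hG
  set main : ℝ → ℝ≥0∞ := fun s => V4 s ^ (1 / 4 : ℝ) * W4 s ^ (1 / 4 : ℝ) * g s ^ (1 / 2 : ℝ) with hmain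
  set H : ℝ → ℝ≥0∞ := fun s => (V4 s ^ (1 / 4 : ℝ) + W4 s ^ (1 / 4 : ℝ)) * g s ^ (1 / 2 : ℝ) with hH
  set err : ℕ → ℝ → ℝ≥0∞ := fun N s => R4 N s ^ (1 / 4 : ℝ) * H s with herr
  -- ### measurability on `(0, T)`
  have hg_m : AEMeasurable g (volume.restrict (Ioo 0 T)) := hu.aemeasurable_eGradNormSq_sub hv
  have hV4_m : AEMeasurable V4 (volume.restrict (Ioo 0 T)) := hv.aemeasurable_lintegral_enorm_pow 4
  have hW4_m : AEMeasurable W4 (volume.restrict (Ioo 0 T)) := hu.aemeasurable_lintegral_enorm_pow_sub hv 4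
  have hR4_m : ∀ N, AEMeasurable (R4 N) (volume.restrict (Ioo 0 T)) := fun N =>
    hu.aemeasurable_lintegral_enorm_pow_four_fourierTruncate_sub hv N
  have hG_m : ∀ N, AEMeasurable (G N) (volume.restrict (Ioo 0 T)) := fun N =>
    hu.aemeasurable_eGradNormSq_fourierTruncate_sub hv N
  have hmain_m : AEMeasurable main (volume.restrict (Ioo 0 T)) :=
    ((hV4_m.pow_const _).mul (hW4_m.pow_const _)).mul (hg_m.pow_const _)
  have hH_m : AEMeasurable H (volume.restrict (Ioo 0 T)) :=
    ((hV4_m.pow_const _).add (hW4_m.pow_const _)).mul (hg_m.pow_const _)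
  -- ### the per-`N` inequality
  have hN : ∀ N, (∫⁻ x, ‖FunctionSpaces.Torus.fourierTruncate N (u t - v t) x‖ₑ ^ 2) +
      2 * ENNReal.ofReal ν * (∫⁻ s in Ioo 0 t, G N s) ≤
        2 * (∫⁻ s in Ioo 0 t, main s) + 2 * ∫⁻ s in Ioo 0 t, err N s := by
    intro N
    have h1 := hu.truncated_difference_le hv hν.le hT hfm hf₂ N ht
    have h2 := hu.lintegral_enorm_trilinear_sub_le hv N ht
    refine h1.trans ?_
    have h3 : ∫⁻ s in Ioo 0 t, (main s + err N s) = (∫⁻ s in Ioo 0 t, main s) + ∫⁻ s in Ioo 0 t, err N s :=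
      lintegral_add_left' (hmain_m.mono_measure hle) _
    rw [← mul_add, ← h3]
    refine mul_le_mul' le_rfl (h2.trans (le_of_eq (lintegral_congr fun s => ?_)))
    simp only [hmain, herr, hH, hV4, hW4, hR4, hg]
    ring
  -- ### the left-hand side in the limit: `∫⁻ ‖P_N w(t)‖ₑ² → ∫⁻ ‖w(t)‖ₑ²`
  have hwt : MemLp (u t - v t) 2 volume := (hu.memLp t ht').sub (hv.memLp t ht')
  have hL1 : Tendsto (fun N => ∫⁻ x, ‖FunctionSpaces.Torus.fourierTruncate N (u t - v t) x‖ₑ ^ 2) atTop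
      (𝓝 (∫⁻ x, ‖u t x - v t x‖ₑ ^ 2)) := by
    have hsum := (ENNReal.summable (f := fun k : Fin 2 → ℤ =>
      ‖mFourierCoeff (FunctionSpaces.EuclideanSpace.complexify ∘ (u t - v t)) k‖ₑ ^ 2)).hasSum
    have h2 : Tendsto (fun N => ∫⁻ x, ‖FunctionSpaces.Torus.fourierTruncate N (u t - v t) x‖ₑ ^ 2) atTop
        (𝓝 (∑' k : Fin 2 → ℤ, ‖mFourierCoeff (FunctionSpaces.EuclideanSpace.complexify ∘ (u t - v t)) k‖ₑ ^ 2)) := by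
      refine (hsum.comp FunctionSpaces.Torus.tendsto_freqBall_atTop).congr fun N => ?_
      exact (Torus.lintegral_enorm_sq_fourierTruncate_eq_sum (hwt.integrable one_le_two) N).symm
    rw [FunctionSpaces.Torus.tsum_enorm_sq_mFourierCoeff_complexify hwt] at h2
    exact h2
  -- ### the dissipation in the limit: `∫⁻ G_N → ∫⁻ g` (monotone convergence)
  have hL2 : Tendsto (fun N => ∫⁻ s in Ioo 0 t, G N s) atTop (𝓝 (∫⁻ s in Ioo 0 t, g s)) := by
    have hcoef : ∀ s ∈ Ioo 0 t, ∀ N, G N s = ENNReal.ofReal (4 * Real.pi ^ 2) *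
        ∑ k ∈ FunctionSpaces.Torus.freqBall N, ENNReal.ofReal (FunctionSpaces.Torus.freqNormSq k) *
          ‖mFourierCoeff (FunctionSpaces.EuclideanSpace.complexify ∘ (u s - v s)) k‖ₑ ^ 2 := by
      intro s hs N
      exact Torus.eGradNormSq_fourierTruncate_eq_sum (((hu.memLp s (Ioo_subset_Icc_self (hsub hs))).sub
        (hv.memLp s (Ioo_subset_Icc_self (hsub hs)))).integrable one_le_two) N
    refine lintegral_tendsto_of_tendsto_of_monotone (fun N => (hG_m N).mono_measure hle) ?_ ?_
    · filter_upwards [ae_restrict_mem measurableSet_Ioo] with s hs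
      intro N N' hNN'
      show G N s ≤ G N' s
      rw [hcoef s hs N, hcoef s hs N']
      exact mul_le_mul' le_rfl (Finset.sum_le_sum_of_subset (FunctionSpaces.Torus.freqBall_mono hNN'))
    · filter_upwards [ae_restrict_mem measurableSet_Ioo] with s hs
      have hsum := (ENNReal.summable (f := fun k : Fin 2 → ℤ =>
        ENNReal.ofReal (FunctionSpaces.Torus.freqNormSq k) *
          ‖mFourierCoeff (FunctionSpaces.EuclideanSpace.complexify ∘ (u s - v s)) k‖ₑ ^ 2)).hasSum
      have h := ENNReal.Tendsto.const_mul (hsum.comp FunctionSpaces.Torus.tendsto_freqBall_atTop)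
        (Or.inr (ENNReal.ofReal_ne_top (r := 4 * Real.pi ^ 2)))
      rw [← FunctionSpaces.Torus.eGradNormSq_eq_tsum] at h
      exact h.congr fun N => (hcoef s hs N).symm
  -- ### the error in the limit: `∫⁻ err_N → 0`
  have hL3 : Tendsto (fun N => ∫⁻ s in Ioo 0 t, err N s) atTop (𝓝 0) := by
    have hpq : (4 : ℝ).HolderConjugate (4 / 3) := by rw [Real.holderConjugate_iff]; norm_num
    set K : ℝ≥0∞ := (∫⁻ s in Ioo 0 t, H s ^ (4 / 3 : ℝ)) ^ (3 / 4 : ℝ) with hK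
    have hKtop : K ≠ ∞ := by
      refine ENNReal.rpow_ne_top_of_nonneg (by norm_num) (lt_top_iff_ne_top.1 ?_)
      exact (lintegral_mono' hle le_rfl).trans_lt (hu.lintegral_holderWeight_lt_top hv hν.le hfm hf₂)
    have hbd : ∀ N, ∫⁻ s in Ioo 0 t, err N s ≤ (∫⁻ s in Ioo 0 T, R4 N s) ^ (1 / 4 : ℝ) * K := by
      intro N
      have h := ENNReal.lintegral_mul_le_Lp_mul_Lq μt hpq (((hR4_m N).pow_const (1 / 4 : ℝ)).mono_measure hle)
        (hH_m.mono_measure hle)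
      have e1 : (fun s => (R4 N s ^ (1 / 4 : ℝ)) ^ (4 : ℝ)) = R4 N := by
        funext s; rw [← ENNReal.rpow_mul]; norm_num
      simp only [e1] at h
      refine h.trans ?_
      rw [show (1 : ℝ) / (4 / 3) = 3 / 4 by norm_num]
      exact mul_le_mul' (ENNReal.rpow_le_rpow (lintegral_mono' hle le_rfl) (by norm_num)) le_rfl
    have hT4 : Tendsto (fun N => (∫⁻ s in Ioo 0 T, R4 N s) ^ (1 / 4 : ℝ) * K) atTop (𝓝 0) := by
      have h1 := hu.tendsto_lintegral_lintegral_enorm_pow_four_fourierTruncate_sub hv hν.le hfm hf₂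
      have h2 : Tendsto (fun N => (∫⁻ s in Ioo 0 T, R4 N s) ^ (1 / 4 : ℝ)) atTop (𝓝 0) := by
        have hc := (ENNReal.continuous_rpow_const (y := (1 / 4 : ℝ))).tendsto 0
        rw [ENNReal.zero_rpow_of_pos (by norm_num)] at hc
        exact hc.comp h1
      have h3 := ENNReal.Tendsto.mul_const h2 (Or.inr hKtop)
      rwa [zero_mul] at h3
    exact tendsto_of_tendsto_of_tendsto_of_le_of_le tendsto_const_nhds hT4 (fun N => bot_le) hbd
  -- ### conclusion
  have hL : Tendsto (fun N => (∫⁻ x, ‖FunctionSpaces.Torus.fourierTruncate N (u t - v t) x‖ₑ ^ 2) +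
      2 * ENNReal.ofReal ν * ∫⁻ s in Ioo 0 t, G N s) atTop
      (𝓝 ((∫⁻ x, ‖u t x - v t x‖ₑ ^ 2) + 2 * ENNReal.ofReal ν * ∫⁻ s in Ioo 0 t, g s)) :=
    hL1.add (ENNReal.Tendsto.const_mul hL2 (Or.inr (ENNReal.mul_ne_top ENNReal.ofNat_ne_top ENNReal.ofReal_ne_top)))
  have hR : Tendsto (fun N => 2 * (∫⁻ s in Ioo 0 t, main s) + 2 * ∫⁻ s in Ioo 0 t, err N s) atTop
      (𝓝 (2 * (∫⁻ s in Ioo 0 t, main s) + 2 * 0)) :=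
    tendsto_const_nhds.add (ENNReal.Tendsto.const_mul hL3 (Or.inr ENNReal.ofNat_ne_top))
  rw [mul_zero, add_zero] at hR
  have hfinal := le_of_tendsto_of_tendsto' hL hR hN
  simpa only [hmain, hV4, hW4, hg] using hfinal

/-- **Discharge of `lions_prodi_uniqueness_torus2`**: uniqueness of Leray–Hopf weak solutions of the
forced Navier–Stokes equations on the flat two-torus (Lions–Prodi 1959; Foias–Manley–Rosa–Temam
2001, Ch. II, Thm. 7.3, uniqueness clause; Constantin–Foias 1988, Thm. 10.1; Kuksin–Shirikyan 2012,
Thm. 2.1.13; Temam 1984, Ch. III, Thm. 3.2) — the accepted assembly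
`lions_prodi_uniqueness_torus2_of_parts` fed with `ladyzhenskaya_torus2_holds` and
`lions_prodi_difference_ineq_torus2_holds`. [cite: FoiasManleyRosaTemam2001, Ch. II Thm. 7.3] -/
theorem lions_prodi_uniqueness_torus2_holds : lions_prodi_uniqueness_torus2 :=
  lions_prodi_uniqueness_torus2_of_parts ladyzhenskaya_torus2_holds lions_prodi_difference_ineq_torus2_holds

end Literature.Analysis.FluidPDE
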